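import Literature.MathematicalPhysics.QuantumFieldTheory.Balaban1983to89.B9Eq3105FamThreeLocDiffGEngine
import Literature.MathematicalPhysics.QuantumFieldTheory.Balaban1983to89.B9Eq3105FamThreeCommStepMember
import Literature.MathematicalPhysics.QuantumFieldTheory.Balaban1983to89.B9Cor36CollarSeparation

/-!
# `Balaban1983to89.B9Eq3105FamThreeLocDiffGAssembly` — FAMILY 3 OF (3.105): THE LOCATED `G′`-DIFFERENCE ENTRY `hDL` AT THE RECORD's LETTERS, FILE F3-E2c —
# per cube □ and direction μ, with the located cut-off `χl_□ = bumpY i (ctrR i □) (3S_j)` (plateau `NearC 9S_j∕4 ⊇ □̃`'s stencils, support `NearC 21S_j∕8`),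
# `conj b(∇_μ(U₁))·conj b((η²·M_{χl_□}·(G′(U₁) − G′_□(Ṽ_□^{u⁻¹})))^ℝ) ≺ ε_D·ℓ(a)·e^{−ρδ₀d}` over `(toB6 (geo9K i) Rr′ Hp, ιB∘blkOf)` — F3-P's `hDL □ μ` SHAPE at
# `χ □ := χl_□`, `Gp := GpY i (parSymY i)` — from F3-E1's identity (`IsUnit Δ′_a(U₁)`, `IsUnit Δ′_{a,□}(Ṽ^{u⁻¹})`, the (3.35) datum), the (3.42) entries 0∕1 of
# `η²G′(U₁)`, F3-E2b's member majorant of the commutator letter, and p38 F3-E2a's two collar SEPARATIONS `B9Cor36CollarSeparation` (USED BY NAME — the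
# separations are DISCHARGED here, `D_sep = 3M_h∕8 − 1`, `D′_sep = 3M_h∕8 − 2`) (sub-row G-B9-LETTERS, GAPS G-B9-p33-01 (D1-left), programme FAMTHREE FILE F3-E2c;
# design `lit-balaban-p33/g103/F3E-SCOPE.md`)

statement-level skeleton of published theorems with citation tags; proofs where landed; nothing here is a claim about the Yang–Mills mass gap

THE PRINTED LOCUS (verbatim, held `paper:balaban1985-cmp99-background-propagators`, journal page = PDF page + 388).  p. 415 l.29–31 «Next we replace the operators
G′_{□₀} and C_{□₀} by G′_□, C_□, terms with the differences G′_{□₀} − G′_□ and C_{□₀} − C_□ are small by the same reason as before.»; p. 412 l.22–36 («an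
exponential factor with a distance between localizations and a closest point where a change was made», «the operators may differ outside □̃₀»); (3.42) p. 397,
(3.49) p. 399, (3.88)–(3.89) p. 409, (3.100) p. 413, Cor. 3.6 p. 408; [4] (2.36) p. 229 (the cut-off's gradient «O(1)(MLʲη)⁻¹» p. 247), (2.51)–(2.55) p. 232,
(2.83)–(2.85) pp. 237–238, Lemma 2.1 (2.61) p. 234; [2] (1.11)–(1.12) (statement type).

WHAT THIS FILE CERTIFIES (kernel-checked; 0 `def`, 0 `def … : Prop`, 0 sorry; standard axioms only)

* §1 (the located cut-off `χl_□ := bumpY i (ctrR i □) (3·SC i □)`, written out — no `def`; its support ∕ plateau lemmas are p38's `B9Cor36CollarSeparation`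
  `nearC_of_chiL_ne_zero` ∕ `chiL_mul_chiY` ∕ `chiL_eq_one_of_{zetaY,hTY}_gradK`, USED BY NAME): `three_SC_pos`, `abs_chiL_le_one`, `nearC_of_chiL_shiftY_ne_zero`
  (`NearC (21S_j∕8 + 1)`), `abs_chiL_shiftY_sub_le` (one lattice step costs `≤ D₁θ∕(3S_j)`, [4] p.247), `abs_one_sub_chiY_le_one`.
* §2 ★★★ `hasMajorant_hDL_chiL` — THE ENTRY: for `U` with `IsUnit Δ′_a(U)` at `parSymY`, `V′ = gaugeY i g⁻¹ (locCfgY i □ η₁ A)` with `IsUnit Δ′_{a,□}(V′)`, the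
  datum's `hQ`∕`hgA`, the entries `hDG`∕`hG` of `η²G′(U)` (kernels `K₁ℓ(a)e^{−δ₀d}`, `K₀ℓ(a)²e^{−δ₀d}`), `hT` = F3-E2b's member majorant `θ·e^{−bδ₀d}` of the
  commutator letter at `V′`, the member (2.61) at `(δ₀, b − ρ)`, `a_sep + ρ ≤ 1`:
  `conj b(∇_μ) * conj b((η²·(M_{χl} ∘ (G′(U) − G′_□(V′))))^ℝ) ≺ ε_D·ℓ(a)·e^{−ρδ₀d}` (real `η²`, F3-P's spelling) with
  `ε_D = (K₁ + |η⁻¹|·(D₁θ∕(3S_j))·(S_j·η_k)·K₀)·(e^{−a_sepδ₀(3M_h∕8 − 1)} + θ·c₁(dB, δ₀, b − ρ)·e^{−a_sepδ₀(3M_h∕8 − 2)})` — the collar rows `S` (blocks meeting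
  `NearC(21S_j∕8 + 1)`) have `ℓ(a) ≤ S_j·η_k` (`pow_levY_le_SC`, `geo9K_len_site`), are `(3M_h∕8 − 1)`-far from the blocks where `χ_□ ≠ 1` and `(3M_h∕8 − 2)`-far
  from the annulus blocks (p38 `collar_le_dist_chiL_chiY` ∕ `collar_le_dist_chiL_annulus`).

HONEST SCOPE ∕ NOT CLAIMED.  DISPLAYED: `hT` (F3-E2b `hasMajorant_conj_commStep_member` from p21 D3's `hR` at the datum), `hDG`∕`hG` (`B9CubeLettersInvReadDict`
from `hE`), `hU`∕`hV`, the datum, the member (2.61), budgets.  With these read off the consumer's context (file F3-E2d), F3-P's `hDL` for `χ □ := χl_□` is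
SUPPLIED and D1-left of GAPS G-B9-p33-01 closes; `hDR` (D1-right) = the mirror F3-E3.  The quality of `ε_D` (print: O(e^{−2δ₀M})) is the separations'
`e^{−a_sepδ₀(3M_h∕8 − 2)}` — smallness in `M_h`, not print's constant, and not claimed to be.  Count-neutral; NOT a node discharge; no summit ∕ sub-problem
statement is proved; nothing continuum ∕ OS ∕ mass-gap ∕ Clay; YM mass gap NOT proved (Track A conditional rung).  No `sorry`, no `axiom`, no `… : Prop` fact,
no `instance`, no `notation`, no `def`.  NEW file; nothing landed is modified.  Cell `lit-balaban`, seat `lit-balaban-p33` gen 103, 2026-08-29;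
`--supports stmt-QuantumFields-19200` as helper.  Net new unproved facts: 0.

RELATED IN THE TREE, NOT DUPLICATED (searched 2026-08-29: `rg 'hDL_chiL|chiL_shiftY' Literature/` = ∅): F3-E1 `B9Eq3105FamThreeLocDiffG`, F3-E2 `…Engine`, F3-E2b
`…CommStepMember`, p38 F3-E2a `B9Cor36CollarSeparation`, p21 `B9ThmDCubePlateau.comm_cutMulY_chiY_deltaPrimeACubeY`, `B9Cor36CubeCutoffs.pow_levY_le_SC`,
`B9Cor36SiteSandwichTransfer.geo9K_len_site`, `B9Cor36CutoffField337` (the bump) — all USED BY NAME.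
-/

noncomputable section

namespace Literature.MathematicalPhysics.QuantumFieldTheory.Balaban1983to89.B9Eq3105FamThreeLocDiffGAssembly

open NormedSpace Complex
open B6RandomWalk (HasMajorant hasMajorant_mono Ineq261 c1_nonneg Triangle254)
open B9Thm34Ext (toB6)
open B9Thm37Sum (mulOp mulOp_apply)
open B9Eq352DivFormLetters (conj)
open B9Eq352GradLetters (diffLetter)
open B9Eq39Adjoint (fluct)
open B9Eq360DeltaPrimeAY (AfldY)
open B6KLevelCensusIndexV1 (KIdx)
open B6Cover236MultiLevelBlocks (cubes)
open B6GlobalChartV1 (PV boxEquiv)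
open B6Geom246MultiLevelBox (blkOf)
open B6Ineq2142KLevelV1 (β)
open B9GeoNormsKLevelV1 (geo9K)
open B9CubeLettersOpsL0 (deltaPrimeACubeY GpCubeY)
open B9Thm37CubeCoverCommutators (cutMulY cutMulY_apply cutMulY_mul KhY)
open B4PartitionUnity22 (thetaProf D1 D1_nonneg contDiff_thetaProf hasCompactSupport_thetaProf)
open B9Cor36CutoffField337 (bumpY abs_bumpY_le_one bumpY_nonneg bumpY_le_one bumpY_eq_one lt_of_bumpY_ne_zero abs_bumpY_shiftY_sub_le)
open B9Cor36CubeCutoffs (SC NearC chiY ctrR locCfgY one_le_SC circR_coord_eq chiY_eq_one_of_nearC nearC_shiftY_symm abs_chiY_le_one)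
open B9Cor36CubeTwinsGeometry (bS)
open B9Cor36CollarSeparation (nearC_of_chiL_ne_zero chiL_mul_chiY collar_le_dist_chiL_chiY collar_le_dist_chiL_annulus)
open B9Cor36CubeCutoffs (pow_levY_le_SC)
open B9Cor36SiteSandwichTransfer (geo9K_len_site)
open B6KLevelCensusIndexV1 (kGeo)
open B9ThmDCubePlateau (comm_cutMulY_chiY_deltaPrimeACubeY)
open B9Eq3105FamTwoCore (geo9K_axioms)
open B9Eq3105FamThreeLocDiffG (cutMulY_GpY_sub_GpCubeY_eq_at cut_sub_eq_oneSided deltaPrimeAY_mul_cutMulY_chiY_at cutMulY_mul_one_sub_eq_zero)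
open B9Eq3105FamThreeLocDiffGEngine (hasMajorant_locDiffEntry conj_diffLetter_mul_cutMulY conj_gradF_cut_locDiff_eq)
open B9Eq3105FamThreeCommStepMember (mulOp_transInd_mul_conj_commStep transIndSite_mem)
open Node00 (SiteY BlkY IBondY CfgY GaugeY toKT shiftY UboxY GpY deltaPrimeAY gaugeY parSymY etaS levY)

variable {d ℓ : ℕ} {hd : 1 ≤ d + 1} {hL : Odd (ℓ + 1) ∧ 1 < ℓ + 1} {b₀ b₁ : ℝ}
variable {𝔸 : Type} [NormedRing 𝔸] [NormedAlgebra ℂ 𝔸] [CompleteSpace 𝔸]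
variable {ι : Type} [Fintype ι]
variable (i : KIdx d ℓ hd hL b₀ b₁) (c : ↥(cubes (toKT i).D.toDomains))

/-! ## §1  The located cut-off `χl_□ = bumpY i (ctrR i □) (3S_j)` -/

section ChiL

/-- `S_j > 0` as a real. [cite: Balaban1984PropagatorsII, (2.1) p.224, bookkeeping] -/
theorem three_SC_pos : (0 : ℝ) < 3 * (SC i c : ℝ) := by
  have h : (1 : ℝ) ≤ (SC i c : ℝ) := by exact_mod_cast one_le_SC i c
  linarith

/-- `|χl_□| ≤ 1`. [cite: Balaban1984PropagatorsI, (1.118) p.36, bookkeeping] -/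
theorem abs_chiL_le_one (z : SiteY i) : |bumpY i (ctrR i c) (3 * (SC i c : ℝ)) z| ≤ 1 := abs_bumpY_le_one i _ _ z

/-- the shifted support: `χl_□(z + e_μ) ≠ 0 ⟹ z ∈ NearC (21S_j∕8 + 1)`. [cite: Balaban1984PropagatorsI, (1.118) p.36, bookkeeping] -/
theorem nearC_of_chiL_shiftY_ne_zero {z : SiteY i} (μ : Fin (d + 1)) (h : bumpY i (ctrR i c) (3 * (SC i c : ℝ)) (shiftY i μ z) ≠ 0) :
    NearC i c (21 * SC i c / 8 + 1) z.1 := by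
  have h1 := nearC_shiftY_symm i c (nearC_of_chiL_ne_zero i c h) μ
  rwa [Equiv.symm_apply_apply] at h1

/-- ★ **THE CUT-OFF's GRADIENT** ([4] p.247 «|∂h_□| ≤ O(1)(MLʲη)⁻¹»): one lattice step changes `χl_□` by at most `D₁θ∕(3S_j)`. [cite: Balaban1984PropagatorsII, p.247, (2.36) p.229] -/
theorem abs_chiL_shiftY_sub_le (μ : Fin (d + 1)) (z : SiteY i) :
    |bumpY i (ctrR i c) (3 * (SC i c : ℝ)) (shiftY i μ z) - bumpY i (ctrR i c) (3 * (SC i c : ℝ)) z| ≤ D1 thetaProf / (3 * (SC i c : ℝ)) :=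
  abs_bumpY_shiftY_sub_le i _ (three_SC_pos i c) μ z

/-- `|1 − χ_□| ≤ 1`. [cite: Balaban1984PropagatorsI, (1.118) p.36, bookkeeping] -/
theorem abs_one_sub_chiY_le_one (z : SiteY i) : |1 - chiY i c z| ≤ 1 := by
  have h0 : 0 ≤ chiY i c z := bumpY_nonneg i _ _ z
  have h1 : chiY i c z ≤ 1 := bumpY_le_one i _ _ z
  rw [abs_le]; constructor <;> linarith

end ChiL

/-! ## §2  The entry `hDL` at the record's letters, separations displayed -/

section Entry

variable (b : Module.Basis ι ℝ 𝔸) [Fintype (geo9K i).Site] [DecidableEq (geo9K i).Site] {Rr' : ℝ} {Hp : Prop}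

open Classical in
set_option maxHeartbeats 3200000 in
/-- ★★★ **THE LOCATED `G′`-DIFFERENCE ENTRY `hDL □ μ` AT THE CUT-OFF `χl_□`**, the collar separations discharged (p38 `B9Cor36CollarSeparation`), modulo the
commutator letter's member majorant (`hT`, F3-E2b), the (3.42) entries of `η²G′(U)` (`hDG`, `hG`), the inverse laws and the datum.  Kernel: `ε_D·ℓ(a)·e^{−ρδ₀d}`,
`ε_D = (K₁ + |η⁻¹|·(D₁θ∕(3S_j))·(S_j·η_k)·K₀)·(e^{−a_sepδ₀(3M_h∕8 − 1)} + θ·c₁(dB, δ₀, b − ρ)·e^{−a_sepδ₀(3M_h∕8 − 2)})`.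
[cite: Balaban1985BackgroundPropagators, p.415 l.29–31, p.412 l.22–36, (3.42) p.397, (3.49) p.399, (3.88)–(3.89) p.409, (3.100) p.413, Cor. 3.6 p.408; Balaban1983RegularityDecay, (1.11)–(1.12) (statement type); Balaban1984PropagatorsII, (2.1) p.224, p.247, (2.46) p.231, (2.51)–(2.55) p.232, (2.83)–(2.85) pp.237–238, Lemma 2.1 (2.61) p.234] -/
theorem hasMajorant_hDL_chiL (ιB : BlkY i → IBondY i) (hι : ∀ s, β i.hN i.D i.hk (ιB s) = s) (U : CfgY 𝔸 i) (g : GaugeY 𝔸 i)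
    {Q : Set (Site (PV d ℓ i.m i.K hd hL) 0)} (η₁ : ℝ) (A : AfldY 𝔸 i)
    (hQ : ∀ x : Site (PV d ℓ i.m i.K hd hL) 0, NearC i c (35 * SC i c / 8 + 1) (boxEquiv i.hN x).1 → x ∈ Q)
    (hgA : ∀ (κ : Fin (d + 1)) (x : Site (PV d ℓ i.m i.K hd hL) 0), x ∈ Q → x.shift κ ∈ Q → gaugeY i g U κ x = fluct η₁ A κ x)
    (hU : IsUnit (deltaPrimeAY i (parSymY i) U)) (hV : IsUnit (deltaPrimeACubeY i c (parSymY i) (gaugeY i g⁻¹ (locCfgY i c η₁ A))))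
    (η : ℝ) (μ : Fin (d + 1)) (dB : ℕ) {K₁ K₀ δ₀ asep ρ bb θ : ℝ}
    (hK₁ : 0 ≤ K₁) (hK₀ : 0 ≤ K₀) (hθ : 0 ≤ θ) (hδ₀ : 0 ≤ δ₀) (hasep : 0 ≤ asep) (hρ : 0 ≤ ρ) (hsplit : asep + ρ ≤ 1)
    (h261 : Ineq261 dB (toB6 (geo9K i) Rr' Hp) δ₀ (bb - ρ))
    (hDG : HasMajorant (g := toB6 (geo9K i) Rr' Hp) (fun p : SiteY i × ι => ιB (blkOf i.D.toDomains p.1))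
      (conj b (diffLetter (shiftY i) (UboxY i U) ((η : ℂ))⁻¹ (Sum.inl μ)) * conj b ((((η ^ 2 : ℝ) : ℂ) • GpY i (parSymY i) U).restrictScalars ℝ))
      (fun a a' => K₁ * (geo9K i).len a * Real.exp (-(δ₀ * (geo9K i).dist a a'))))
    (hG : HasMajorant (g := toB6 (geo9K i) Rr' Hp) (fun p : SiteY i × ι => ιB (blkOf i.D.toDomains p.1))
      (conj b ((((η ^ 2 : ℝ) : ℂ) • GpY i (parSymY i) U).restrictScalars ℝ))
      (fun a a' => K₀ * (geo9K i).len a ^ 2 * Real.exp (-(δ₀ * (geo9K i).dist a a'))))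
    (hT : HasMajorant (g := toB6 (geo9K i) Rr' Hp) (fun p : SiteY i × ι => ιB (blkOf i.D.toDomains p.1))
      (conj b (((cutMulY (𝔸 := 𝔸) (chiY i c) * deltaPrimeACubeY i c (parSymY i) (gaugeY i g⁻¹ (locCfgY i c η₁ A)) -
          deltaPrimeACubeY i c (parSymY i) (gaugeY i g⁻¹ (locCfgY i c η₁ A)) * cutMulY (𝔸 := 𝔸) (chiY i c)) *
        GpCubeY i c (parSymY i) (gaugeY i g⁻¹ (locCfgY i c η₁ A))).restrictScalars ℝ))
      (fun y a' => θ * Real.exp (-(bb * δ₀ * (geo9K i).dist y a')))) :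
    HasMajorant (g := toB6 (geo9K i) Rr' Hp) (fun p : SiteY i × ι => ιB (blkOf i.D.toDomains p.1))
      (conj b (diffLetter (shiftY i) (UboxY i U) ((η : ℂ))⁻¹ (Sum.inl μ)) *
        conj b (((η ^ 2 : ℝ) • (cutMulY (𝔸 := 𝔸) (bumpY i (ctrR i c) (3 * (SC i c : ℝ))) ∘ₗ
          (GpY i (parSymY i) U - GpCubeY i c (parSymY i) (gaugeY i g⁻¹ (locCfgY i c η₁ A))))).restrictScalars ℝ))
      (fun a a' => ((K₁ + (|η⁻¹| * (D1 thetaProf / (3 * (SC i c : ℝ)))) * ((SC i c : ℝ) * (kGeo i).eta) * K₀) *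
          (Real.exp (-(asep * δ₀ * (3 / 8 * (i.Mh : ℝ) - 1))) + θ * B6.c1 dB δ₀ (bb - ρ) * Real.exp (-(asep * δ₀ * (3 / 8 * (i.Mh : ℝ) - 2))))) *
        (geo9K i).len a * Real.exp (-(ρ * δ₀ * (geo9K i).dist a a'))) := by
  obtain ⟨htri, hsymm, hdnn⟩ := geo9K_axioms i Rr' Hp
  have hS1 := one_le_SC i c
  -- p38's collar separations (F3-E2a `B9Cor36CollarSeparation`), in the engine's Finset form
  have hsep : ∀ a ∈ (Finset.univ.filter fun a : IBondY i => ∃ z : SiteY i, ιB (blkOf i.D.toDomains z) = a ∧ NearC i c (21 * SC i c / 8 + 1) z.1),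
      ∀ y ∈ (Finset.univ.filter fun a : IBondY i => ∃ z : SiteY i, ιB (blkOf i.D.toDomains z) = a ∧ chiY i c z ≠ 1),
        3 / 8 * (i.Mh : ℝ) - 1 ≤ (geo9K i).dist a y := fun a ha y hy => by
    obtain ⟨z, rfl, hz⟩ := (Finset.mem_filter.1 ha).2
    obtain ⟨w, rfl, hw⟩ := (Finset.mem_filter.1 hy).2
    exact collar_le_dist_chiL_chiY i c ιB hι hz hw
  have hsep' : ∀ a ∈ (Finset.univ.filter fun a : IBondY i => ∃ z : SiteY i, ιB (blkOf i.D.toDomains z) = a ∧ NearC i c (21 * SC i c / 8 + 1) z.1),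
      ∀ y ∈ (Finset.univ.filter fun a : IBondY i => ∃ z : SiteY i, ιB (blkOf i.D.toDomains z) = a ∧ ¬ NearC i c (3 * SC i c - (bS i c : ℤ)) z.1),
        3 / 8 * (i.Mh : ℝ) - 2 ≤ (geo9K i).dist a y := fun a ha y hy => by
    obtain ⟨z, rfl, hz⟩ := (Finset.mem_filter.1 ha).2
    obtain ⟨w, rfl, hw⟩ := (Finset.mem_filter.1 hy).2
    exact collar_le_dist_chiL_annulus i c ιB hι hz hw
  -- the collar row-size bound `ℓ(a) ≤ S_j·η` ([4] (2.1): blocks near □ have level ≤ j+1)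
  have hη0 : 0 ≤ (kGeo i).eta := by
    show (0 : ℝ) ≤ |i.cf|⁻¹
    positivity
  have hℓS : ∀ a ∈ (Finset.univ.filter fun a : IBondY i => ∃ z : SiteY i, ιB (blkOf i.D.toDomains z) = a ∧ NearC i c (21 * SC i c / 8 + 1) z.1),
      (geo9K i).len a ^ 2 ≤ ((SC i c : ℝ) * (kGeo i).eta) * (geo9K i).len a := fun a ha => by
    obtain ⟨z, rfl, hz⟩ := (Finset.mem_filter.1 ha).2
    have hle : (geo9K i).len (ιB (blkOf i.D.toDomains z)) ≤ (SC i c : ℝ) * (kGeo i).eta := by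
      rw [geo9K_len_site i ιB hι z]
      refine mul_le_mul_of_nonneg_right ?_ hη0
      have h1 := pow_levY_le_SC i c (r := 21 * SC i c / 8 + 1) (by omega) hz
      have h2 : (((ℓ + 1) ^ levY i z : ℕ) : ℝ) ≤ ((SC i c : ℤ) : ℝ) := by exact_mod_cast h1
      push_cast at h2
      exact h2
    rw [sq]
    exact mul_le_mul_of_nonneg_right hle (B9GeoLemma21KLevelV1.geo9K_len_pos i _).le
  -- the real scalar `η²` as a complex one (F3-P's binder carries the real `smul`)
  rw [show ((η ^ 2 : ℝ) • (cutMulY (𝔸 := 𝔸) (bumpY i (ctrR i c) (3 * (SC i c : ℝ))) ∘ₗ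
      (GpY i (parSymY i) U - GpCubeY i c (parSymY i) (gaugeY i g⁻¹ (locCfgY i c η₁ A)))) : Module.End ℂ (SiteY i → 𝔸)) =
      (((η ^ 2 : ℝ) : ℂ)) • (cutMulY (𝔸 := 𝔸) (bumpY i (ctrR i c) (3 * (SC i c : ℝ))) ∘ₗ
        (GpY i (parSymY i) U - GpCubeY i c (parSymY i) (gaugeY i g⁻¹ (locCfgY i c η₁ A)))) from (algebraMap_smul ℂ (η ^ 2) _).symm]
  set V' : CfgY 𝔸 i := gaugeY i g⁻¹ (locCfgY i c η₁ A) with hV'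
  set χl : SiteY i → ℝ := bumpY i (ctrR i c) (3 * (SC i c : ℝ)) with hχl
  -- F3-E1's identity at the record, in p21's commutator spelling
  have hId : cutMulY (𝔸 := 𝔸) χl * (GpY i (parSymY i) U - GpCubeY i c (parSymY i) V') =
      cutMulY (𝔸 := 𝔸) χl * GpY i (parSymY i) U * (1 - cutMulY (𝔸 := 𝔸) (chiY i c)) +
        cutMulY (𝔸 := 𝔸) χl * GpY i (parSymY i) U *
          (cutMulY (𝔸 := 𝔸) (chiY i c) * deltaPrimeACubeY i c (parSymY i) V' - deltaPrimeACubeY i c (parSymY i) V' * cutMulY (𝔸 := 𝔸) (chiY i c)) *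
            GpCubeY i c (parSymY i) V' := by
    rw [comm_cutMulY_chiY_deltaPrimeACubeY i c V']
    exact cutMulY_GpY_sub_GpCubeY_eq_at i c g U η₁ A hQ hgA hU hV χl (chiL_mul_chiY i c)
  -- the real-coordinate decomposition (engine §2), then the letter-free engine
  rw [conj_gradF_cut_locDiff_eq i b U η μ χl (chiY i c) (GpY i (parSymY i) U) (GpCubeY i c (parSymY i) V')
    (cutMulY (𝔸 := 𝔸) (chiY i c) * deltaPrimeACubeY i c (parSymY i) V' - deltaPrimeACubeY i c (parSymY i) V' * cutMulY (𝔸 := 𝔸) (chiY i c)) hId]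
  refine hasMajorant_locDiffEntry (Rg := Rr') (Hg := Hp) (fun p : SiteY i × ι => ιB (blkOf i.D.toDomains p.1)) dB
    (fun p : SiteY i × ι => χl p.1) (fun p : SiteY i × ι => χl (shiftY i μ p.1)) (fun p : SiteY i × ι => η⁻¹ * (χl (shiftY i μ p.1) - χl p.1))
    (fun p : SiteY i × ι => 1 - chiY i c p.1) (fun p : SiteY i × ι => if NearC i c (3 * SC i c - (bS i c : ℤ)) p.1.1 then (0 : ℝ) else 1)
    (fun a => (geo9K i).len a) (fun a => (geo9K i).len a ^ 2) _ _ _ hK₁ hK₀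
    (mul_nonneg (abs_nonneg _) (div_nonneg (D1_nonneg contDiff_thetaProf hasCompactSupport_thetaProf) (three_SC_pos i c).le))
    (mul_nonneg (by exact_mod_cast (show (0 : ℤ) ≤ SC i c by omega)) hη0) hθ
    (fun a => (B9GeoLemma21KLevelV1.geo9K_len_pos i a).le) hδ₀ hasep hρ hsplit htri hsymm hdnn h261
    (conj_diffLetter_mul_cutMulY i b U η μ χl) (fun p => abs_chiL_le_one i c _) (fun p hp => ?_) (fun p => ?_) (fun p hp => ?_) hℓS
    (fun p => abs_one_sub_chiY_le_one i c p.1) (fun p hp => ?_) hsep (fun p => by split_ifs <;> simp) (fun p hp => transIndSite_mem i c ιB p hp)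
    (mulOp_transInd_mul_conj_commStep i c b (parSymY i) V') hsep' hDG hG hT
  · -- rows of `χl(·+e_μ)` lie in the collar blocks
    by_contra h
    exact hp (Finset.mem_filter.2 ⟨@Finset.mem_univ _ (_) _, p.1, rfl, nearC_of_chiL_shiftY_ne_zero i c μ h⟩)
  · -- the difference-quotient multiplier
    rw [abs_mul]
    exact mul_le_mul_of_nonneg_left (abs_chiL_shiftY_sub_le i c μ p.1) (abs_nonneg _)
  · -- its rows lie in the collar blocks too
    by_contra h
    have h' : χl (shiftY i μ p.1) - χl p.1 ≠ 0 := fun h0 => h (by rw [h0, mul_zero])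
    by_cases h1 : χl (shiftY i μ p.1) = 0
    · have h2 : χl p.1 ≠ 0 := fun h2 => h' (by rw [h1, h2, sub_zero])
      exact hp (Finset.mem_filter.2 ⟨@Finset.mem_univ _ (_) _, p.1, rfl, (nearC_of_chiL_ne_zero i c h2).mono i c (by omega)⟩)
    · exact hp (Finset.mem_filter.2 ⟨@Finset.mem_univ _ (_) _, p.1, rfl, nearC_of_chiL_shiftY_ne_zero i c μ h1⟩)
  · -- columns of `1 − χ_□` lie where `χ_□ ≠ 1`
    exact Finset.mem_filter.2 ⟨@Finset.mem_univ _ (_) _, p.1, rfl, fun h1 => hp (by rw [h1, sub_self])⟩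

end Entry

end Literature.MathematicalPhysics.QuantumFieldTheory.Balaban1983to89.B9Eq3105FamThreeLocDiffGAssembly

end
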